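import Summits.FinalStateConjecture.FinalStateConjecture.Theorems.ZeroEnergyRigidity.Negative.KerrParameterSign
import Literature.Geometry.Lorentzian.KerrData
import HarnessLib

/-!
# Crux `PhaseMixingCapture.BulkKerrCaptureC2` (stmt-FinalStateConjecture-14985): SPIN REVERSAL `a ↦ −a` —
# the Kerr–Schild chart under the coordinate reflection `x₂ ↦ −x₂`

Support file for the crux `BulkKerrCaptureC2` (sub-extremal Kerr capture in the bulk, import grade).  The Kerr family
has the discrete symmetry "reversing the sense of rotation": in ingoing Kerr–Schild Cartesian coordinates the reflection
`L (t*, x₁, x₂, x₃) = (t*, x₁, −x₂, x₃)` of `ℝ⁴` is an isometry of `g_{M,−a}` onto `g_{M,a}`,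
`g_{M,−a}(x)(v, w) = g_{M,a}(L x)(L v, L w)`, preserving `t*`, the Kerr–Schild radius `r`, the scalar `H` and the time
orientation `−g♯dt*` (Kerr–Schild 1965, §2: `ℓ = (1, (r x + a y)/(r² + a²), (r y − a x)/(r² + a²), z/r)` — the sign
of `a` is the sense of rotation of the congruence about the `z`-axis; O'Neill 1995, Ch. 2, §2.1: "`a ↦ −a` …
reverses the direction of rotation").  This file is the coordinate algebra of that symmetry, phrased for ANY Euclidean
linear isometry `L` of `E4 = ℝ⁴` with the coordinate description `(L x)ᵢ = xᵢ` (`i ≠ 2`), `(L x)₂ = −x₂` (and its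
spatial trace `L₃` on `E3 = ℝ³`, `(L₃ y)₁ = −y₁`), so that no new definition is introduced:

* §0 `exists_reflections` (such `L`, `L₃` exist: `LinearIsometryEquiv.piLpCongrRight`), `exists_bilinearCompIsometry`
  (for a linear isometry `L` of a normed space `F`, `A ↦ A(L ·, L ·)` is a linear isometry of `F →L F →L ℝ`);
* §1 `reflect_reflect`, `spatialNorm_reflect`, `ofTimeSpace_reflect₃` (`(t, L₃ y) = L (t, y)`);
* §2 the Kerr–Schild scalars and (co)vectors: `radius_reflect` (`r(a, L x) = r(a, x)`; evenness in the spin,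
  `r(−a, x) = r(a, x)`, is `ZeroEnergyRigidity.Negative.radius_neg` of `…/ZeroEnergyRigidity/Negative/KerrParameterSign`,
  which treats the same reflection as the concrete map `reflY` for another crux and is reused here),
  `scalarH_neg`/`scalarH_reflect`, `nullCovector_reflect` (`ℓ_{−a}(x)(v) = ℓ_a(L x)(L v)`), `minkowski_bilin_reflect`,
  **`bilin_reflect`** (`g_{M,−a}(x)(v, w) = g_{M,a}(L x)(L v, L w)`), `reflect_nullVector`, `reflect_timeVector`
  (`L V_{M,−a}(x) = V_{M,a}(L x)`), `reflect_sliceNormal`;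
* §3 the domains: `rMinus_neg`, `afRadius_neg` (`rPlus_neg`, `isSubextremal_neg_iff` are reused from
  `KerrParameterSign`), `reflect_mem_region_iff`, `reflect_mem_exterior_iff`, `reflect₃_mem_slice_iff`.

Sequels: `…ReflectionConvergence` (`ConvergesToKerr 𝒟 M a k ↔ ConvergesToKerr 𝒟 M (−a) k`), `…ReflectionData`
(`L₃^* Kerr.data M a r₀ = Kerr.data M (−a) r₀`), `…ReflectionSobolev`, `…ReflectionCapture` (the crux is equivalent to
its restriction to spins `0 ≤ a ≤ a₁ M`).  Everything is proved; no definitions, no named facts.  References: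
R. P. Kerr, A. Schild (1965), §2; M. Visser, arXiv:0706.0622, (32)–(35); B. O'Neill, *The geometry of Kerr black
holes* (1995), Ch. 2, §2.1; G. B. Cook, Living Rev. Relativ. 3 (2000) 5, §3.2.2.
-/

-- the doubled `FinalStateConjecture.FinalStateConjecture` path component trips dupNamespace
set_option linter.dupNamespace false

noncomputable section

open Set Function
open scoped Manifold ContDiff Topology
open Literature.Geometry.Lorentzian
open Summit.FinalStateConjecture.FinalStateConjecture.Theorems.ZeroEnergyRigidity.Negative (radius_neg rPlus_neg)

namespace Summit.FinalStateConjecture.FinalStateConjecture.Theorems.BulkKerrCaptureC2.Reflection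

/-! ## §0 Existence of the coordinate reflections; the induced isometry of bilinear forms -/

/-- **The coordinate reflections exist as Euclidean linear isometries**: there are linear isometric automorphisms
`L` of `E4` and `L₃` of `E3` with `(L x)ᵢ = xᵢ` for `i ≠ 2`, `(L x)₂ = −x₂`, and `(L₃ y)ᵢ = yᵢ` for `i ≠ 1`,
`(L₃ y)₁ = −y₁` (coordinatewise `±1`, `LinearIsometryEquiv.piLpCongrRight`). [folklore] -/
theorem exists_reflections :
    ∃ (L : E4 ≃ₗᵢ[ℝ] E4) (L₃ : E3 ≃ₗᵢ[ℝ] E3),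
      (∀ (x : E4) (i : Fin 4), L x i = if i = 2 then -x i else x i) ∧
      ∀ (y : E3) (i : Fin 3), L₃ y i = if i = 1 then -y i else y i := by
  refine ⟨LinearIsometryEquiv.piLpCongrRight 2 fun i : Fin 4 ↦
      if i = 2 then LinearIsometryEquiv.neg ℝ else LinearIsometryEquiv.refl ℝ ℝ,
    LinearIsometryEquiv.piLpCongrRight 2 fun i : Fin 3 ↦
      if i = 1 then LinearIsometryEquiv.neg ℝ else LinearIsometryEquiv.refl ℝ ℝ,
    fun x i ↦ ?_, fun y i ↦ ?_⟩
  · rw [LinearIsometryEquiv.piLpCongrRight_apply, PiLp.toLp_apply]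
    split_ifs <;> simp
  · rw [LinearIsometryEquiv.piLpCongrRight_apply, PiLp.toLp_apply]
    split_ifs <;> simp

/-- The operator norm of `A(L' ·, L' ·)` is at most that of `A`, for a linear isometry `L'`. [folklore] -/
theorem norm_bilinearComp_isometry_le {F : Type*} [NormedAddCommGroup F] [NormedSpace ℝ F]
    (L' : F ≃ₗᵢ[ℝ] F) (A : F →L[ℝ] F →L[ℝ] ℝ) :
    ‖A.bilinearComp (L'.toContinuousLinearEquiv : F →L[ℝ] F)
        (L'.toContinuousLinearEquiv : F →L[ℝ] F)‖ ≤ ‖A‖ := by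
  refine ContinuousLinearMap.opNorm_le_bound _ (norm_nonneg A) fun v ↦
    ContinuousLinearMap.opNorm_le_bound _ (by positivity) fun w ↦ ?_
  rw [ContinuousLinearMap.bilinearComp_apply]
  calc ‖A ((L'.toContinuousLinearEquiv : F →L[ℝ] F) v) ((L'.toContinuousLinearEquiv : F →L[ℝ] F) w)‖
      ≤ ‖A‖ * ‖(L'.toContinuousLinearEquiv : F →L[ℝ] F) v‖ *
          ‖(L'.toContinuousLinearEquiv : F →L[ℝ] F) w‖ := A.le_opNorm₂ _ _
    _ = ‖A‖ * ‖v‖ * ‖w‖ := by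
        rw [show (L'.toContinuousLinearEquiv : F →L[ℝ] F) v = L' v from rfl,
          show (L'.toContinuousLinearEquiv : F →L[ℝ] F) w = L' w from rfl, L'.norm_map, L'.norm_map]

/-- **Precomposition with a linear isometry in both slots is a linear isometry of the space of continuous bilinear
forms**: for `L : F ≃ₗᵢ F` there is a linear isometric automorphism `Φ` of `F →L F →L ℝ` with
`Φ A (v, w) = A (L v, L w)` (inverse: precomposition with `L⁻¹`; both are norm-non-increasing). [folklore] -/
theorem exists_bilinearCompIsometry {F : Type*} [NormedAddCommGroup F] [NormedSpace ℝ F] (L : F ≃ₗᵢ[ℝ] F) :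
    ∃ Φ : (F →L[ℝ] F →L[ℝ] ℝ) ≃ₗᵢ[ℝ] (F →L[ℝ] F →L[ℝ] ℝ), ∀ (A : F →L[ℝ] F →L[ℝ] ℝ) (v w : F),
      Φ A v w = A (L v) (L w) := by
  -- the forward and backward maps
  let T : (F →L[ℝ] F →L[ℝ] ℝ) → (F →L[ℝ] F →L[ℝ] ℝ) := fun A ↦
    A.bilinearComp (L.toContinuousLinearEquiv : F →L[ℝ] F) (L.toContinuousLinearEquiv : F →L[ℝ] F)
  let S : (F →L[ℝ] F →L[ℝ] ℝ) → (F →L[ℝ] F →L[ℝ] ℝ) := fun A ↦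
    A.bilinearComp (L.symm.toContinuousLinearEquiv : F →L[ℝ] F) (L.symm.toContinuousLinearEquiv : F →L[ℝ] F)
  have hT : ∀ A v w, T A v w = A (L v) (L w) := fun A v w ↦ rfl
  have hS : ∀ A v w, S A v w = A (L.symm v) (L.symm w) := fun A v w ↦ rfl
  have hST : ∀ A, S (T A) = A := fun A ↦ by
    refine ContinuousLinearMap.ext fun v ↦ ContinuousLinearMap.ext fun w ↦ ?_
    rw [hS, hT, L.apply_symm_apply, L.apply_symm_apply]
  have hTS : ∀ A, T (S A) = A := fun A ↦ by
    refine ContinuousLinearMap.ext fun v ↦ ContinuousLinearMap.ext fun w ↦ ?_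
    rw [hT, hS, L.symm_apply_apply, L.symm_apply_apply]
  let Tl : (F →L[ℝ] F →L[ℝ] ℝ) ≃ₗ[ℝ] (F →L[ℝ] F →L[ℝ] ℝ) :=
    { toFun := T
      invFun := S
      map_add' := fun A B ↦ by
        refine ContinuousLinearMap.ext fun v ↦ ContinuousLinearMap.ext fun w ↦ ?_
        simp only [hT, add_apply]
      map_smul' := fun c A ↦ by
        refine ContinuousLinearMap.ext fun v ↦ ContinuousLinearMap.ext fun w ↦ ?_
        simp only [hT, FunLike.coe_smul, Pi.smul_apply, RingHom.id_apply]
      left_inv := hST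
      right_inv := hTS }
  refine ⟨{ toLinearEquiv := Tl, norm_map' := fun A ↦ le_antisymm (norm_bilinearComp_isometry_le L A) ?_ }, hT⟩
  have h := norm_bilinearComp_isometry_le L.symm (T A)
  change ‖S (T A)‖ ≤ ‖T A‖ at h
  rwa [hST] at h

/-! ## §1 The reflection of `E4` and its spatial trace -/

section Reflect

variable {L : E4 ≃ₗᵢ[ℝ] E4} (hL : ∀ (x : E4) (i : Fin 4), L x i = if i = 2 then -x i else x i)
include hL

/-- `(L x)₀ = x₀`: the reflection preserves `t*`. [folklore] -/
theorem reflect_apply_zero (x : E4) : L x 0 = x 0 := by rw [hL, if_neg (by decide)]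

/-- `(L x)₁ = x₁`. [folklore] -/
theorem reflect_apply_one (x : E4) : L x 1 = x 1 := by rw [hL, if_neg (by decide)]

/-- `(L x)₂ = −x₂`. [folklore] -/
theorem reflect_apply_two (x : E4) : L x 2 = -x 2 := by rw [hL, if_pos rfl]

/-- `(L x)₃ = x₃`: the reflection preserves `z`. [folklore] -/
theorem reflect_apply_three (x : E4) : L x 3 = x 3 := by rw [hL, if_neg (by decide)]

/-- The reflection is an involution: `L (L x) = x`. [folklore] -/
theorem reflect_reflect (x : E4) : L (L x) = x := by
  ext i
  rw [hL, hL]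
  split_ifs <;> simp

/-- … hence it is its own inverse. [folklore] -/
theorem reflect_symm_apply (x : E4) : L.symm x = L x := by
  conv_lhs => rw [← reflect_reflect hL x]
  exact L.symm_apply_apply _

/-- The reflection fixes the time axis: `L ∂_{t*} = ∂_{t*}`. [folklore] -/
theorem reflect_basisVector_zero : L (E4.basisVector 0) = E4.basisVector 0 := by
  ext i
  rw [hL]
  fin_cases i <;> simp

/-- **The spatial radius is invariant**: `‖(L x)⃗‖ = ‖x⃗‖`. [folklore] -/
theorem spatialNorm_reflect (x : E4) : E4.spatialNorm (L x) = E4.spatialNorm x := by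
  have h1 : E4.spatialNorm (L x) ^ 2 = E4.spatialNorm x ^ 2 := by
    rw [E4.spatialNorm_sq, E4.spatialNorm_sq, reflect_apply_one hL, reflect_apply_two hL,
      reflect_apply_three hL, neg_sq]
  exact (pow_left_inj₀ (E4.spatialNorm_nonneg _) (E4.spatialNorm_nonneg _) two_ne_zero).1 h1

variable {L₃ : E3 ≃ₗᵢ[ℝ] E3} (hL₃ : ∀ (y : E3) (i : Fin 3), L₃ y i = if i = 1 then -y i else y i)
include hL₃

omit hL in
/-- The spatial reflection is an involution: `L₃ (L₃ y) = y`. [folklore] -/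
theorem reflect₃_reflect₃ (y : E3) : L₃ (L₃ y) = y := by
  ext i
  rw [hL₃, hL₃]
  split_ifs <;> simp

omit hL in
/-- … hence it is its own inverse. [folklore] -/
theorem reflect₃_symm_apply (y : E3) : L₃.symm y = L₃ y := by
  conv_lhs => rw [← reflect₃_reflect₃ hL₃ y]
  exact L₃.symm_apply_apply _

/-- **The spatial reflection is the trace of `L` on the slabs `{t* = t}`**: `(t, L₃ y) = L (t, y)`. [folklore] -/
theorem ofTimeSpace_reflect₃ (t : ℝ) (y : E3) : E4.ofTimeSpace t (L₃ y) = L (E4.ofTimeSpace t y) := by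
  ext i
  refine Fin.cases ?_ (fun j ↦ ?_) i
  · rw [E4.ofTimeSpace_apply_zero, reflect_apply_zero hL, E4.ofTimeSpace_apply_zero]
  · rw [E4.ofTimeSpace_apply_succ, hL₃, hL, E4.ofTimeSpace_apply_succ]
    fin_cases j <;> simp

end Reflect

/-! ## §2 The Kerr–Schild scalars, the null (co)vector, the metric and the unit normal -/

section KerrSchild

/-- **The Kerr–Schild scalar is even in the spin**: `H_{M,−a}(x) = H_{M,a}(x)`. Visser arXiv:0706.0622, (33).
[cite: arXiv07060622, (33)] -/
theorem scalarH_neg (M a : ℝ) (x : E4) : Kerr.scalarH M (-a) x = Kerr.scalarH M a x := by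
  unfold Kerr.scalarH
  rw [radius_neg, neg_sq]

/-- The Cauchy-horizon radius is even in the spin: `r₋(M, −a) = r₋(M, a)`. [folklore] -/
theorem rMinus_neg (M a : ℝ) : Kerr.rMinus M (-a) = Kerr.rMinus M a := by
  unfold Kerr.rMinus; rw [neg_sq]

/-- The inner coordinate radius of the asymptotically flat end is even in the spin. [folklore] -/
theorem afRadius_neg (a r₀ : ℝ) : Kerr.afRadius (-a) r₀ = Kerr.afRadius a r₀ := by
  unfold Kerr.afRadius; rw [neg_sq]

variable {L : E4 ≃ₗᵢ[ℝ] E4} (hL : ∀ (x : E4) (i : Fin 4), L x i = if i = 2 then -x i else x i)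
include hL

/-- **The Kerr–Schild radius is invariant under the reflection**: `r(a, L x) = r(a, x)` (it depends on `‖x⃗‖` and
`z` only). Visser arXiv:0706.0622, (35). [cite: arXiv07060622, (35)] -/
theorem radius_reflect (a : ℝ) (x : E4) : Kerr.radius a (L x) = Kerr.radius a x := by
  unfold Kerr.radius
  rw [spatialNorm_reflect hL, reflect_apply_three hL]

/-- **`H` is invariant under the reflection**: `H_{M,a}(L x) = H_{M,a}(x)`. Visser arXiv:0706.0622, (33).
[cite: arXiv07060622, (33)] -/
theorem scalarH_reflect (M a : ℝ) (x : E4) : Kerr.scalarH M a (L x) = Kerr.scalarH M a x := by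
  unfold Kerr.scalarH
  rw [radius_reflect hL, reflect_apply_three hL]

/-- **The null covector reverses its sense of rotation under the reflection**:
`ℓ_{−a}(x)(v) = ℓ_a(L x)(L v)` — with `ℓ_a = (1, (r x₁ + a x₂)/(r² + a²), (r x₂ − a x₁)/(r² + a²), x₃/r)`, flipping
the signs of `x₂`, `v₂` and `a` together leaves `∑ ℓ_μ v^μ` unchanged. Kerr–Schild 1965, §2; Visser
arXiv:0706.0622, (34). [cite: KerrSchild1965, §2] -/
theorem nullCovector_reflect (a : ℝ) (x v : E4) :
    Kerr.nullCovector (-a) x v = Kerr.nullCovector a (L x) (L v) := by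
  simp only [Kerr.nullCovector, E4.covector_apply, Fin.sum_univ_four, Kerr.nullCovectorFun, radius_neg,
    radius_reflect hL, reflect_apply_zero hL, reflect_apply_one hL, reflect_apply_two hL, reflect_apply_three hL,
    Fin.isValue, Matrix.cons_val_zero, Matrix.cons_val_one, Matrix.cons_val]
  ring

/-- **The Minkowski form is invariant under the reflection**: `η(L v, L w) = η(v, w)`. O'Neill 1983, Ch. 3, p. 55.
[cite: ONeill1983, Ch. 3, p. 55] -/
theorem minkowski_bilin_reflect (v w : E4) : Minkowski.bilin (L v) (L w) = Minkowski.bilin v w := by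
  have e3 : (2 : Fin 3).succ = (3 : Fin 4) := rfl
  rw [Minkowski.bilin_apply, Minkowski.bilin_apply, Fin.sum_univ_three, Fin.sum_univ_three]
  simp only [Fin.succ_zero_eq_one, Fin.succ_one_eq_two, e3, reflect_apply_zero hL, reflect_apply_one hL,
    reflect_apply_two hL, reflect_apply_three hL]
  ring

/-- **Spin reversal is an isometry of the Kerr–Schild family**: `g_{M,−a}(x)(v, w) = g_{M,a}(L x)(L v, L w)` — the
reflection `x₂ ↦ −x₂` maps `g_{M,−a}` isometrically onto `g_{M,a}` (`g = η + 2H ℓ ⊗ ℓ` with `η`, `H` invariant and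
`ℓ_{−a}(x) = ℓ_a(L x) ∘ L`).  Kerr–Schild 1965, §2; O'Neill 1995, Ch. 2, §2.1 ("`a ↦ −a` reverses the direction of
rotation"). [cite: KerrSchild1965, §2] -/
theorem bilin_reflect (M a : ℝ) (x v w : E4) :
    Kerr.bilin M (-a) x v w = Kerr.bilin M a (L x) (L v) (L w) := by
  rw [Kerr.bilin_apply, Kerr.bilin_apply, scalarH_neg, scalarH_reflect hL, nullCovector_reflect hL a x v,
    nullCovector_reflect hL a x w, minkowski_bilin_reflect hL]

/-- **The null vector is equivariant**: `L ℓ♯_{−a}(x) = ℓ♯_a(L x)`. Kerr–Schild 1965, §2. [cite: KerrSchild1965, §2] -/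
theorem reflect_nullVector (a : ℝ) (x : E4) : L (Kerr.nullVector (-a) x) = Kerr.nullVector a (L x) := by
  ext i
  rw [hL]
  fin_cases i <;>
    simp [Kerr.nullVector, Kerr.nullCovectorFun, radius_neg, radius_reflect hL, reflect_apply_one hL,
      reflect_apply_two hL, reflect_apply_three hL]
  ring

/-- **The time-orientation field is equivariant**: `L V_{M,−a}(x) = V_{M,a}(L x)` for `V = ∂_{t*} − 2H ℓ♯`
(Dafermos–Rodnianski arXiv:0811.0354, §5.1). [cite: arXiv08110354, §5.1] -/
theorem reflect_timeVector (M a : ℝ) (x : E4) : L (Kerr.timeVector M (-a) x) = Kerr.timeVector M a (L x) := by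
  unfold Kerr.timeVector
  rw [map_sub, map_smul, reflect_basisVector_zero hL, reflect_nullVector hL, scalarH_neg, scalarH_reflect hL]

variable {L₃ : E3 ≃ₗᵢ[ℝ] E3} (hL₃ : ∀ (y : E3) (i : Fin 3), L₃ y i = if i = 1 then -y i else y i)
include hL₃

/-- **The future unit normal of the slice `{t* = 0}` is equivariant**: `L ν_{M,−a}(y) = ν_{M,a}(y')` whenever
`y' = L₃ y` as points of `ℝ³` (`ν = (1 + 2H)^{-1/2} V`, Cook 2000, §3.2.2, with `H` invariant and `V` equivariant).
[cite: Cook2000, §3.2.2] -/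
theorem reflect_sliceNormal (M a r₀ : ℝ) (y : Kerr.slice (-a) r₀) (y' : Kerr.slice a r₀)
    (hy : (y' : E3) = L₃ y) :
    L (Kerr.sliceNormal M (-a) r₀ y) = Kerr.sliceNormal M a r₀ y' := by
  rw [Kerr.sliceNormal_apply, Kerr.sliceNormal_apply, hy, ofTimeSpace_reflect₃ hL hL₃, map_smul,
    reflect_timeVector hL, scalarH_neg, scalarH_reflect hL]

end KerrSchild

/-! ## §3 The chart domains, the exterior and the slice -/

section Domains

variable {L : E4 ≃ₗᵢ[ℝ] E4} (hL : ∀ (x : E4) (i : Fin 4), L x i = if i = 2 then -x i else x i)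
include hL

/-- **The reflection maps the chart `Kerr.region (−a) r₀` onto `Kerr.region a r₀`**:
`L x ∈ {r(a, ·) > max r₀ 0} ↔ x ∈ {r(−a, ·) > max r₀ 0}`. [folklore] -/
theorem reflect_mem_region_iff {a r₀ : ℝ} {x : E4} : L x ∈ Kerr.region a r₀ ↔ x ∈ Kerr.region (-a) r₀ := by
  rw [Kerr.mem_region, Kerr.mem_region, radius_reflect hL, radius_neg]

/-- **The reflection maps the exterior `Kerr.exterior M (−a)` onto `Kerr.exterior M a`** (`r₊` is even in `a`).
[folklore] -/
theorem reflect_mem_exterior_iff {M a : ℝ} {x : E4} : L x ∈ Kerr.exterior M a ↔ x ∈ Kerr.exterior M (-a) := by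
  rw [Kerr.mem_exterior, Kerr.mem_exterior, radius_reflect hL, radius_neg, rPlus_neg]

variable {L₃ : E3 ≃ₗᵢ[ℝ] E3} (hL₃ : ∀ (y : E3) (i : Fin 3), L₃ y i = if i = 1 then -y i else y i)
include hL₃

/-- **The spatial reflection maps the slice `Kerr.slice (−a) r₀` onto `Kerr.slice a r₀`**:
`L₃ y ∈ Kerr.slice a r₀ ↔ y ∈ Kerr.slice (−a) r₀`. [folklore] -/
theorem reflect₃_mem_slice_iff {a r₀ : ℝ} {y : E3} : L₃ y ∈ Kerr.slice a r₀ ↔ y ∈ Kerr.slice (-a) r₀ := by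
  rw [Kerr.mem_slice, Kerr.mem_slice, ofTimeSpace_reflect₃ hL hL₃, radius_reflect hL, radius_neg]

/-- … equivalently, with the roles of `a` and `−a` exchanged (the reflection is an involution). [folklore] -/
theorem reflect₃_mem_slice_iff' {a r₀ : ℝ} {y : E3} : L₃ y ∈ Kerr.slice (-a) r₀ ↔ y ∈ Kerr.slice a r₀ := by
  rw [← reflect₃_mem_slice_iff hL hL₃ (a := a) (y := L₃ y), reflect₃_reflect₃ hL₃]

end Domains

/-- **Registered sub-goal `stub_bilin_reflect`** (crux item stmt-FinalStateConjecture-14985): spin reversal is an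
isometry of the Kerr–Schild family — for every Euclidean linear isometry `L` of `ℝ⁴` with `(L x)ᵢ = xᵢ` (`i ≠ 2`),
`(L x)₂ = −x₂`: `g_{M,−a}(x)(v, w) = g_{M,a}(L x)(L v, L w)` (closed form of `bilin_reflect`). [cite: KerrSchild1965, §2] -/
theorem stub_bilin_reflect : ∀ (L : E4 ≃ₗᵢ[ℝ] E4), (∀ (x : E4) (i : Fin 4), L x i = if i = 2 then -x i else x i) → ∀ (M a : ℝ) (x v w : E4), Kerr.bilin M (-a) x v w = Kerr.bilin M a (L x) (L v) (L w) :=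
  fun _ hL M a x v w ↦ bilin_reflect hL M a x v w

end Summit.FinalStateConjecture.FinalStateConjecture.Theorems.BulkKerrCaptureC2.Reflection

end
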